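import Literature.Probability.Process.DoobMartingaleTails
import Literature.Probability.Process.StoppedValuePairing
import Mathlib.Order.Filter.AtTopBot.Basic
import HarnessLib

/-!
# Per-scale data for the passage of a discrete Doob martingale to a scaling limit

Topic `Literature/Probability/Process`; theorems only. Bookkeeping between the two halves of the
proof that "the martingale property of a discrete observable passes to the scaling limit"
(Duminil-Copin–Smirnov, Clay Math. Proc. 15 (2012), proof of Prop. 6.7; Chelkak–Duminil-Copin–
Hongler–Kemppainen–Smirnov, C. R. Math. 352 (2014), §3) when the discrete observable is NOT
bounded but is the Doob martingale `G_n = κ · E_k[X_k ∣ 𝒢_n]` of nonnegative terminal variables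
`X_k` with uniformly small tails along the scales `k` (uniform integrability):

* the LATTICE half delivers, for every small tolerance `ρ > 0` and all large scales `k`, an
  exploration filtration `𝒢`, a version `G` of the Doob martingale, stopping times `σ ≤ τ ≤ M`
  (first steps of capacity `≥ s`, `≥ t`) for which the driving values `V^k_u`, `u ≤ s`, are
  `𝒢_σ`-measurable, and an exceptional event `bad` of probability `≤ ρ` off which `G_σ`, `G_τ`
  are within `ρ` of a target functional `Φ^k_u` at some times `u ∈ [s, s + ρ]`, `[t, t + ρ]`;
* the ANALYTIC half (`Loewner.integral_cylinder_eq_zero_of_tendstoInDistribution` and its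
  uniformly-integrable variant) consumes, for EVERY scale `k`, two integrable random variables
  `A, B`, an exceptional event with `P_k(bad) ≤ η_k`, tail bounds `∫_{bad} ‖A‖, ∫_{bad} ‖B‖ ≤ η_k`,
  the pairing identity `E_k[(B - A) ψ(V^k_S)] = 0` and the approximations within `ε_k` at times
  within `Δ_k`, with null sequences `ε, Δ, η`.

`exists_passageData_of_doob` produces the second from the first: a diagonal extraction
(`exists_tendsto_atTop_eventually_of_forall_eventually`) chooses the tolerance `ρ_k → 0` as a
function of the scale, slowly enough that the uniform-integrability level `R(ε)` of the terminal
variables is affordable (`R ρ → 0`); the pairing identity is Doob's optional sampling theorem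
(`integral_stoppedValue_sub_mul_cylinder_eq_zero`) for the complexified martingale; the tail
bounds are `setIntegral_abs_stoppedValue_le_of_ae_eq_condExp`; the finitely many small scales get
trivial data.

No definitions, no named facts.

## References

* D. Chelkak, H. Duminil-Copin, C. Hongler, A. Kemppainen, S. Smirnov, C. R. Math. Acad. Sci.
  Paris 352 (2014) 157–161, §3.
* H. Duminil-Copin, S. Smirnov, Clay Math. Proc. 15 (2012), Lemma 6.6 and proof of Prop. 6.7.
* D. Williams, *Probability with Martingales* (1991), Thm. 13.4.
-/

noncomputable section

open MeasureTheory Filter Set Topology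
open scoped ENNReal NNReal

namespace Literature.Probability.Process

/-! ### Diagonal extraction -/

/-- **Diagonal extraction.** If for every precision level `j` the property `good j n` holds for
all large `n`, then there is a level sequence `J n → ∞` with `good (J n) n` for all large `n`.
[folklore] -/
theorem exists_tendsto_atTop_eventually_of_forall_eventually {good : ℕ → ℕ → Prop}
    (h : ∀ j, ∀ᶠ n in atTop, good j n) :
    ∃ J : ℕ → ℕ, Tendsto J atTop atTop ∧ ∀ᶠ n in atTop, good (J n) n := by
  classical
  choose K hK using fun j ↦ eventually_atTop.1 (h j)
  refine ⟨fun n ↦ Nat.findGreatest (fun j ↦ K j + j ≤ n) n, ?_, ?_⟩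
  · refine tendsto_atTop_atTop.2 fun j ↦ ⟨K j + j, fun n hn ↦ ?_⟩
    exact Nat.le_findGreatest (le_trans (Nat.le_add_left j (K j)) hn) hn
  · refine eventually_atTop.2 ⟨K 0, fun n hn ↦ ?_⟩
    have hspec : K (Nat.findGreatest (fun j ↦ K j + j ≤ n) n) +
        Nat.findGreatest (fun j ↦ K j + j ≤ n) n ≤ n :=
      Nat.findGreatest_spec (P := fun j ↦ K j + j ≤ n) (Nat.zero_le n) (by simpa using hn)
    exact hK _ n (le_trans (Nat.le_add_right _ _) hspec)

/-! ### From Doob-martingale data at all small tolerances to per-scale passage data -/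

variable {Ω' : ℕ → Type*} {mΩ' : ∀ k, MeasurableSpace (Ω' k)} {P : ∀ k, Measure (Ω' k)}
  [∀ k, IsProbabilityMeasure (P k)]

/-- **Per-scale passage data from a Doob martingale with uniformly integrable terminal values.**
Probability spaces `(Ω' k, P k)`; real processes `V k` (driving values) and complex targets
`Φ k u` (the limiting observable read on the path of `V k`); terminal variables `X k`, for all
large `k` nonnegative measurable integrable, with UNIFORMLY SMALL TAILS (`hUI`); a constant `κ`; times `S_i ≤ s`, `t`;
a measurable cylinder function `|ψ| ≤ 1`. Hypothesis `hD`: for all small `ρ > 0` and all large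
`k` there are a filtration `𝒢`, a strongly adapted `G` with `G_m = κ E_k[X_k ∣ 𝒢_m]` a.e.,
stopping times `σ ≤ τ ≤ M` with every `V^k_u`, `u ≤ s`, measurable for `𝒢_σ`, and a measurable
`bad` with `P_k(bad) ≤ ρ`, off which `G_σ` (`G_τ`) is within `ρ` of `Φ^k_u` at some
`u ∈ [s, s + ρ]` (`[t, t + ρ]`). Conclusion: null sequences `ε, Δ, η` and, for EVERY `k`,
integrable `A, B` and `bad` with `P_k(bad) ≤ η_k`, `∫⁻_{bad} ‖A‖ₑ, ∫⁻_{bad} ‖B‖ₑ ≤ η_k`,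
`E_k[(B - A) ψ(V^k_S)] = 0`, and a.e. off `bad` the approximations within `ε_k` at times within
`Δ_k` — the hypothesis `happrox` of the uniformly-integrable passage theorem. (For large `k`:
`A = G_σ`, `B = G_τ` at the tolerance `ρ_{J k}` of a diagonal extraction; optional sampling gives
the pairing identity; `∫_{bad} |G_σ| ≤ |κ| (R ρ + ε)` by
`setIntegral_abs_stoppedValue_le_of_ae_eq_condExp`; small `k` get `A = B = 0`, `bad = univ`.)
[cite: CDHKSCRAS2014, §3] -/
theorem exists_passageData_of_doob
    {V : ∀ k, ℝ≥0 → Ω' k → ℝ} {Φ : ∀ k, ℝ≥0 → Ω' k → ℂ} {X : ∀ k, Ω' k → ℝ}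
    (hX : ∀ᶠ k in atTop, Measurable (X k) ∧ (∀ ω, 0 ≤ X k ω) ∧ Integrable (X k) (P k))
    (hUI : ∀ ε : ℝ, 0 < ε → ∃ R : ℝ, ∀ᶠ k in atTop, ∫ ω in {ω | R < X k ω}, X k ω ∂P k ≤ ε)
    (κ : ℝ) (s t : ℝ≥0) {n : ℕ} {S : Fin n → ℝ≥0} (hS : ∀ i, S i ≤ s)
    {ψ : (Fin n → ℝ) → ℝ} (hψm : Measurable ψ) (hψ1 : ∀ v, |ψ v| ≤ 1)
    (hD : ∀ᶠ ρ in 𝓝[>] (0 : ℝ), ∀ᶠ k in atTop,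
      ∃ (𝒢 : Filtration ℕ (mΩ' k)) (G : ℕ → Ω' k → ℝ) (σ τ : Ω' k → WithTop ℕ)
        (hσ : IsStoppingTime 𝒢 σ) (M : ℕ) (bad : Set (Ω' k)),
        IsStoppingTime 𝒢 τ ∧ StronglyAdapted 𝒢 G ∧
        (∀ m, G m =ᵐ[P k] fun ω ↦ κ * ((P k)[X k | 𝒢 m]) ω) ∧
        σ ≤ τ ∧ (∀ ω, τ ω ≤ M) ∧ (∀ u, u ≤ s → Measurable[hσ.measurableSpace] (V k u)) ∧
        MeasurableSet bad ∧ P k bad ≤ ENNReal.ofReal ρ ∧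
        ∀ ω, ω ∉ bad →
          (∃ u : ℝ≥0, s ≤ u ∧ (u : ℝ) ≤ s + ρ ∧ ‖((stoppedValue G σ ω : ℝ) : ℂ) - Φ k u ω‖ ≤ ρ) ∧
          (∃ u : ℝ≥0, t ≤ u ∧ (u : ℝ) ≤ t + ρ ∧ ‖((stoppedValue G τ ω : ℝ) : ℂ) - Φ k u ω‖ ≤ ρ)) :
    ∃ ε Δ η : ℕ → ℝ≥0, Tendsto ε atTop (𝓝 0) ∧ Tendsto Δ atTop (𝓝 0) ∧ Tendsto η atTop (𝓝 0) ∧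
      ∀ k, ∃ (A B : Ω' k → ℂ) (bad : Set (Ω' k)), MeasurableSet bad ∧ P k bad ≤ η k ∧
        Integrable A (P k) ∧ Integrable B (P k) ∧
        ∫⁻ ω in bad, ‖A ω‖ₑ ∂P k ≤ η k ∧ ∫⁻ ω in bad, ‖B ω‖ₑ ∂P k ≤ η k ∧
        ∫ ω, (B ω - A ω) * (ψ (fun i ↦ V k (S i) ω) : ℂ) ∂P k = 0 ∧
        ∀ᵐ ω ∂P k, ω ∉ bad →
          (∃ u ∈ Icc s (s + Δ k), ‖A ω - Φ k u ω‖ ≤ ε k) ∧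
          (∃ u ∈ Icc t (t + Δ k), ‖B ω - Φ k u ω‖ ≤ ε k) := by
  classical
  -- Step 0: the tolerance range `(0, ρ₀)` of `hD` and the UI levels
  obtain ⟨ρ₀, hρ₀, hD'⟩ := mem_nhdsGT_iff_exists_Ioo_subset.1 hD
  rw [mem_Ioi] at hρ₀
  choose R hR using hUI
  -- precision level `j`: `εj = 1/(j+1)`, UI level `Rj ≥ 0`, tolerance `ρj`
  set εj : ℕ → ℝ := fun j ↦ 1 / ((j : ℝ) + 1) with hεj
  have hεj_pos : ∀ j, 0 < εj j := fun j ↦ by rw [hεj]; positivity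
  set Rj : ℕ → ℝ := fun j ↦ max (R (εj j) (hεj_pos j)) 0 with hRj
  have hRj0 : ∀ j, 0 ≤ Rj j := fun j ↦ le_max_right _ _
  set ρj : ℕ → ℝ := fun j ↦ min (ρ₀ / 2) (1 / (((j : ℝ) + 1) * (Rj j + 1))) with hρj
  have hρj_pos : ∀ j, 0 < ρj j := fun j ↦ by
    have := hRj0 j
    rw [hρj]
    positivity
  have hρj_lt : ∀ j, ρj j < ρ₀ := fun j ↦ (min_le_left _ _).trans_lt (by linarith)
  have hρj_le : ∀ j, ρj j ≤ εj j := fun j ↦ by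
    have h1 : ρj j ≤ 1 / (((j : ℝ) + 1) * (Rj j + 1)) := min_le_right _ _
    refine h1.trans ?_
    rw [hεj]
    apply one_div_le_one_div_of_le (by positivity)
    have := hRj0 j
    nlinarith
  have hRρ : ∀ j, Rj j * ρj j ≤ εj j := fun j ↦ by
    have h1 : ρj j ≤ 1 / (((j : ℝ) + 1) * (Rj j + 1)) := min_le_right _ _
    have h0 := hRj0 j
    calc Rj j * ρj j ≤ (Rj j + 1) * (1 / (((j : ℝ) + 1) * (Rj j + 1))) := by
          gcongr
          linarith
      _ = εj j := by rw [hεj]; field_simp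
  -- Step 1: diagonal extraction
  have hgood : ∀ j, ∀ᶠ k in atTop,
      (∃ (𝒢 : Filtration ℕ (mΩ' k)) (G : ℕ → Ω' k → ℝ) (σ τ : Ω' k → WithTop ℕ)
        (hσ : IsStoppingTime 𝒢 σ) (M : ℕ) (bad : Set (Ω' k)),
        IsStoppingTime 𝒢 τ ∧ StronglyAdapted 𝒢 G ∧
        (∀ m, G m =ᵐ[P k] fun ω ↦ κ * ((P k)[X k | 𝒢 m]) ω) ∧
        σ ≤ τ ∧ (∀ ω, τ ω ≤ M) ∧ (∀ u, u ≤ s → Measurable[hσ.measurableSpace] (V k u)) ∧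
        MeasurableSet bad ∧ P k bad ≤ ENNReal.ofReal (ρj j) ∧
        ∀ ω, ω ∉ bad →
          (∃ u : ℝ≥0, s ≤ u ∧ (u : ℝ) ≤ s + ρj j ∧
            ‖((stoppedValue G σ ω : ℝ) : ℂ) - Φ k u ω‖ ≤ ρj j) ∧
          (∃ u : ℝ≥0, t ≤ u ∧ (u : ℝ) ≤ t + ρj j ∧
            ‖((stoppedValue G τ ω : ℝ) : ℂ) - Φ k u ω‖ ≤ ρj j)) ∧
      ∫ ω in {ω | R (εj j) (hεj_pos j) < X k ω}, X k ω ∂P k ≤ εj j ∧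
      (Measurable (X k) ∧ (∀ ω, 0 ≤ X k ω) ∧ Integrable (X k) (P k)) := fun j ↦
    (hD' ⟨hρj_pos j, hρj_lt j⟩).and ((hR (εj j) (hεj_pos j)).and hX)
  obtain ⟨J, hJ, hJgood⟩ := exists_tendsto_atTop_eventually_of_forall_eventually hgood
  obtain ⟨K₀, hK₀⟩ := eventually_atTop.1 hJgood
  -- Step 2: the sequences
  have hεJ : Tendsto (fun k ↦ εj (J k)) atTop (𝓝 0) :=
    (tendsto_one_div_add_atTop_nhds_zero_nat (𝕜 := ℝ)).comp hJ
  set C₀ : ℝ := 2 * |κ| + 1 with hC₀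
  have hC₀1 : 1 ≤ C₀ := by
    rw [hC₀]
    have := abs_nonneg κ
    linarith
  refine ⟨fun k ↦ ⟨ρj (J k), (hρj_pos _).le⟩, fun k ↦ ⟨ρj (J k), (hρj_pos _).le⟩,
    fun k ↦ if K₀ ≤ k then (C₀ * εj (J k)).toNNReal else 1, ?_, ?_, ?_, fun k ↦ ?_⟩
  · rw [← NNReal.tendsto_coe]
    exact tendsto_of_tendsto_of_tendsto_of_le_of_le tendsto_const_nhds hεJ
      (fun k ↦ (hρj_pos _).le) (fun k ↦ hρj_le _)
  · rw [← NNReal.tendsto_coe]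
    exact tendsto_of_tendsto_of_tendsto_of_le_of_le tendsto_const_nhds hεJ
      (fun k ↦ (hρj_pos _).le) (fun k ↦ hρj_le _)
  · have h1 : Tendsto (fun k ↦ (C₀ * εj (J k)).toNNReal) atTop (𝓝 0) := by
      have h := (hεJ.const_mul C₀)
      rw [mul_zero] at h
      have h2 := (continuous_real_toNNReal.tendsto 0).comp h
      rwa [Real.toNNReal_zero] at h2
    refine h1.congr' ?_
    filter_upwards [eventually_ge_atTop K₀] with k hk
    rw [if_pos hk]
  -- Step 3: the data at scale `k`
  dsimp only
  by_cases hk : K₀ ≤ k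
  swap
  · -- small scales: trivial data
    refine ⟨0, 0, univ, MeasurableSet.univ, ?_, integrable_zero _ _ _, integrable_zero _ _ _,
      by simp, by simp, by simp, ae_of_all _ fun ω hω ↦ absurd (mem_univ ω) hω⟩
    rw [if_neg hk, measure_univ]
    simp
  obtain ⟨⟨𝒢, G, σ, τ, hσ, M, bad, hτ, hGad, hG, hστ, hτM, hV, hbad, hPbad, happ⟩, htail,
    hXm, hX0, hXi⟩ := hK₀ k hk
  set j := J k with hj
  have hσM : ∀ ω, σ ω ≤ M := fun ω ↦ (hστ ω).trans (hτM ω)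
  have hmart : Martingale G 𝒢 (P k) := martingale_of_ae_eq_const_mul_condExp κ hGad hG
  have hmartC : Martingale (fun m ω ↦ (G m ω : ℂ)) 𝒢 (P k) := martingale_ofReal hmart
  have hintσ : Integrable (stoppedValue G σ) (P k) :=
    integrable_stoppedValue ℕ hσ hmart.integrable hσM
  have hintτ : Integrable (stoppedValue G τ) (P k) :=
    integrable_stoppedValue ℕ hτ hmart.integrable hτM
  have hη : (if K₀ ≤ k then (C₀ * εj (J k)).toNNReal else 1) = (C₀ * εj j).toNNReal := by
    rw [if_pos hk]
  -- the tail bound at a stopping time `θ ≤ M`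
  have htailθ : ∀ {θ : Ω' k → WithTop ℕ} (hθ : IsStoppingTime 𝒢 θ) (hθM : ∀ ω, θ ω ≤ M),
      Integrable (stoppedValue G θ) (P k) →
      ∫⁻ ω in bad, ‖((stoppedValue G θ ω : ℝ) : ℂ)‖ₑ ∂P k ≤ ((C₀ * εj j).toNNReal : ℝ≥0) := by
    intro θ hθ hθM hintθ
    have henorm : ∀ x : ℝ, ‖(x : ℂ)‖ₑ = ‖x‖ₑ := fun x ↦ by
      rw [← ofReal_norm, Complex.norm_real, ofReal_norm]
    have h1 : ∫⁻ ω in bad, ‖((stoppedValue G θ ω : ℝ) : ℂ)‖ₑ ∂P k =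
        ENNReal.ofReal (∫ ω in bad, |stoppedValue G θ ω| ∂P k) := by
      simp_rw [henorm]
      rw [← ofReal_integral_norm_eq_lintegral_enorm hintθ.integrableOn]
      simp only [Real.norm_eq_abs]
    rw [h1]
    change _ ≤ ENNReal.ofReal (C₀ * εj j)
    refine ENNReal.ofReal_le_ofReal ?_
    have h2 := setIntegral_abs_stoppedValue_le_of_ae_eq_condExp hXm hX0 hXi hGad hG
      hθ hθM bad (hRj0 j)
    have hPreal : (P k).real bad ≤ ρj j := by
      rw [measureReal_def]
      exact ENNReal.toReal_le_of_le_ofReal (hρj_pos j).le hPbad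
    have h3 : ∫ ω in {ω | Rj j < X k ω}, X k ω ∂P k ≤ εj j := by
      refine le_trans ?_ htail
      refine setIntegral_mono_set hXi.integrableOn (ae_of_all _ hX0)
        (ae_of_all _ fun ω (hω : Rj j < X k ω) ↦ ?_)
      exact lt_of_le_of_lt (le_max_left _ _) hω
    have hκ := abs_nonneg κ
    calc ∫ ω in bad, |stoppedValue G θ ω| ∂P k
        ≤ |κ| * (Rj j * (P k).real bad + ∫ ω in {ω | Rj j < X k ω}, X k ω ∂P k) := h2
      _ ≤ |κ| * (Rj j * ρj j + εj j) := by gcongr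
      _ ≤ |κ| * (εj j + εj j) := by gcongr; exact hRρ j
      _ ≤ C₀ * εj j := by rw [hC₀]; nlinarith [hεj_pos j]
  refine ⟨fun ω ↦ ((stoppedValue G σ ω : ℝ) : ℂ), fun ω ↦ ((stoppedValue G τ ω : ℝ) : ℂ), bad,
    hbad, ?_,
    hintσ.ofReal, hintτ.ofReal, ?_, ?_, ?_, ae_of_all _ fun ω hω ↦ ?_⟩
  · -- `P bad ≤ η`
    rw [hη]
    change _ ≤ ENNReal.ofReal (C₀ * εj j)
    refine hPbad.trans (ENNReal.ofReal_le_ofReal ((hρj_le j).trans ?_))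
    have := hεj_pos j
    nlinarith
  · rw [hη]; exact htailθ hσ hσM hintσ
  · rw [hη]; exact htailθ hτ hτM hintτ
  · -- optional sampling, pairing form
    exact integral_stoppedValue_sub_mul_cylinder_eq_zero hmartC hσ hτ hστ hτM
      (fun i ↦ hV (S i) (hS i)) hψm hψ1
  · -- the approximations
    obtain ⟨⟨u, hsu, hus, hA⟩, ⟨u', htu, hut, hB⟩⟩ := happ ω hω
    refine ⟨⟨u, ⟨hsu, ?_⟩, hA⟩, ⟨u', ⟨htu, ?_⟩, hB⟩⟩
    · rw [← NNReal.coe_le_coe, NNReal.coe_add]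
      exact hus
    · rw [← NNReal.coe_le_coe, NNReal.coe_add]
      exact hut

end Literature.Probability.Process

end
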